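import Literature.MathematicalPhysics.QuantumFieldTheory.Balaban1983to89.Beta.BalabanStepW2
import Literature.MathematicalPhysics.QuantumFieldTheory.Balaban1983to89.Beta.AveragingMixedJetTables

/-!
# MixedJetTablesPlug — an1's node-12b tables plugged into an2's recursive second-order family (cell result, β sub-cell row an1)

HONEST FRAMING.  Discharging `BetaPertH` would make Bałaban's UV stability UNCONDITIONAL — a constructive-QFT result; it is NOT the
continuum limit and NOT the Clay problem.  This leaf discharges nothing of `BetaPertH`.  It records, in the kernel, that the four
hypotheses on the two table binders of `Beta/BalabanStepW2.lean` §6b (`hB`/`hBt` on `vh₂S`, `hmix`/`hmixt` on `mixFF`) are instances of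
the four socket theorems of `Beta/AveragingMixedJetTables.lean` at `vh₂S := vh₂SAt (toSite r) Lc`, `mixFF := mixFFAt (toSite r) Lc` for
ANY box root `r ∈ box (d+1) Lc` (centred root `ctrOff (d+1) Lc`, `ctrOff_mem_box`), so that the instantiated family `JsBalT2Of` — here
named `JsBalAn1` — carries NO table hypothesis: its binders are `1 ≤ Lc`, the colour constants `cE cVH cΛ cE₂ cB` ((P6), pinned last by
the β-lead), the Wilson position table `T` (by value) and the root.  Its (Wt)/(St♭) laws and the `TbalOf` read-out are an2's theorems
instantiated, by name.
CONTENTS: `hmix_an1`, `hmixt_an1`, `hB_an1`, `hBt_an1` (the four binder hypotheses, discharged); `T2Of_loc_an1`; `JsBalAn1` (any root) with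
`JsBalAn1_W_translate` (Wt), `JsBalAn1_S_translate` (St♭), `TbalOf_JsBalAn1` (the wall's family member by member, `d = 3`); the centred
instance `JsBalAn1Ctr hLc cE cVH cΛ cE₂ cB T : ℕ → JetData 3 Lc` with `JsBalAn1Ctr_eq`, `TbalOf_JsBalAn1Ctr`, `JsBalAn1Ctr_W_translate`,
`JsBalAn1Ctr_S_translate`.  Every proof is a one-line application; no tactic blocks.
ABSOLUTE RULE respected: nothing printed is cited or used as a hypothesis; every statement is an application of landed [folklore]
theorems of this package by name (a CELL RESULT in the sense of the β-lead's (R34-2): no `[cite:]` tag is claimed because no printed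
statement is reproduced).  One-writer note: `JsBalT2Of`/`T2Of` are an2's objects and are only INSTANTIATED here; `vh₂SAt`/`mixFFAt` and
their four laws are an1's (node 12b).
-/

open Literature.MathematicalPhysics.QuantumFieldTheory.Balaban1983to89
open Literature.MathematicalPhysics.QuantumFieldTheory.Balaban1983to89.Beta
open Literature.MathematicalPhysics.QuantumFieldTheory.Balaban1983to89.Beta.AffineAveraging
open Literature.MathematicalPhysics.QuantumFieldTheory.Balaban1983to89.Beta.AveragingContoursRooted
open Literature.MathematicalPhysics.QuantumFieldTheory.Balaban1983to89.Beta.AveragingMixedJetTables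
open Literature.MathematicalPhysics.QuantumFieldTheory.Balaban1983to89.Beta.BalabanStepW2
open ExpKernelCalculus (MKer BiLoc shiftK hessKer)
open OneStepResolventKernel (Fib JetData)
open OneStepKernelFamily (KInvStep TbalOf)
open AxialDressing (axDressK axVertexOfK)
open BalabanStepJetsSucc (JsBal0Of)
open Beta.SecondOrderResponse (LocStencilFM)
open Beta.BalabanCompositeJets (LocStencil₂)

namespace Summit.QuantumFields.BalabanUV.Beta.MixedJetTablesPlug

noncomputable section

variable {d : ℕ} {Lc : ℕ} [NeZero Lc] {r : Fin (d + 1) → ℕ}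

omit [NeZero Lc] in
/-- `hmix` of `BalabanStepW2` for an1's `mixFFAt` at a box root (rate `1`; any positive rate works). -/
theorem hmix_an1 (hLc : 1 ≤ Lc) (hr : r ∈ box (d + 1) Lc) :
    ∃ C δ : ℝ, 0 < δ ∧ LocStencilFM Lc (mixFFAt (toSite r) Lc) C δ :=
  ⟨_, 1, one_pos, fun κ u μ y => biLoc_mixFFAt hLc hr zero_le_one κ u μ y⟩

omit [NeZero Lc] in
/-- `hmixt` of `BalabanStepW2` for an1's `mixFFAt` (every root, no side condition). -/
theorem hmixt_an1 (ρ : Fin (d + 1) → ℤ) :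
    ∀ (κ : Fin (d + 1)) (u : Fin (d + 1) → ℤ) (μ : Fin (d + 1)) (w t : Fin (d + 1) → ℤ),
      mixFFAt ρ Lc κ (u + (Lc : ℤ) • t) μ (w + t) = shiftK (-((Lc : ℤ) • t)) (mixFFAt ρ Lc κ u μ w) :=
  fun κ u μ w t => mixFFAt_translate ρ Lc κ u μ w t

omit [NeZero Lc] in
/-- `hB` of `BalabanStepW2` for an1's `vh₂SAt` at a box root (rate `1`). -/
theorem hB_an1 (hLc : 1 ≤ Lc) (hr : r ∈ box (d + 1) Lc) :
    ∃ C δ : ℝ, 0 < δ ∧ LocStencil₂ (vh₂SAt (toSite r) Lc) C δ :=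
  ⟨_, 1, one_pos, fun κ u κ' u' => biLoc_vh₂SAt hLc hr zero_le_one κ u κ' u'⟩

omit [NeZero Lc] in
/-- `hBt` of `BalabanStepW2` for an1's `vh₂SAt` (every root; `1 ≤ Lc`). -/
theorem hBt_an1 (hLc : 1 ≤ Lc) (ρ : Fin (d + 1) → ℤ) :
    ∀ (κ : Fin (d + 1)) (u : Fin (d + 1) → ℤ) (κ' : Fin (d + 1)) (u' t : Fin (d + 1) → ℤ),
      vh₂SAt ρ Lc κ (u + (Lc : ℤ) • t) κ' (u' + (Lc : ℤ) • t) = shiftK (-((Lc : ℤ) • t)) (vh₂SAt ρ Lc κ u κ' u') :=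
  fun κ u κ' u' t => vh₂SAt_translate hLc ρ κ u κ' u' t

/-- an2's recursive second-order table family is a `LocStencil₂` family member by member, with an1's tables plugged in. -/
theorem T2Of_loc_an1 (hLc : 1 ≤ Lc) (hr : r ∈ box (d + 1) Lc) (cE cVH cΛ cE₂ cB : ℝ)
    (T : Fin 4 → Fin 4 → Fin 4 → Fin 4 → ℝ) (j : ℕ) :
    ∃ C δ : ℝ, 0 < δ ∧
      LocStencil₂ (T2Of d Lc cE cVH cΛ cE₂ cB T (vh₂SAt (toSite r) Lc) (mixFFAt (toSite r) Lc) j) C δ :=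
  T2Of_loc hLc cE cVH cΛ cE₂ cB T (hB_an1 hLc hr) (hmix_an1 hLc hr) j

/-- an2's dressed jet-data family with recursive tables, an1's tables plugged in: NO table hypothesis left. -/
def JsBalAn1 (hLc : 1 ≤ Lc) (hr : r ∈ box (d + 1) Lc) (cE cVH cΛ cE₂ cB : ℝ)
    (T : Fin 4 → Fin 4 → Fin 4 → Fin 4 → ℝ) : ℕ → JetData d Lc :=
  JsBalT2Of hLc cE cVH cΛ cE₂ cB T (hB_an1 hLc hr) (hmix_an1 hLc hr)

/-- (Wt) for the plugged-in family — both border covariance hypotheses discharged by an1's translate laws. -/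
theorem JsBalAn1_W_translate (hLc : 1 ≤ Lc) (hr : r ∈ box (d + 1) Lc) (cE cVH cΛ cE₂ cB : ℝ)
    (T : Fin 4 → Fin 4 → Fin 4 → Fin 4 → ℝ) (j : ℕ) (μ : Fin (d + 1)) (y : Fin (d + 1) → ℤ) (ν : Fin (d + 1))
    (y' t : Fin (d + 1) → ℤ) :
    (JsBalAn1 hLc hr cE cVH cΛ cE₂ cB T j).W μ (y + t) ν (y' + t)
      = shiftK (-((Lc : ℤ) • t)) ((JsBalAn1 hLc hr cE cVH cΛ cE₂ cB T j).W μ y ν y') :=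
  JsBalT2Of_W_translate hLc cE cVH cΛ cE₂ cB T (hB_an1 hLc hr) (hmix_an1 hLc hr)
    (hBt_an1 hLc (toSite r)) (hmixt_an1 (toSite r)) j μ y ν y' t

/-- (St♭) for the plugged-in family. -/
theorem JsBalAn1_S_translate (hLc : 1 ≤ Lc) (hr : r ∈ box (d + 1) Lc) (cE cVH cΛ cE₂ cB : ℝ)
    (T : Fin 4 → Fin 4 → Fin 4 → Fin 4 → ℝ) (j : ℕ) (κ' : Fin (d + 1)) (u t : Fin (d + 1) → ℤ) :
    (JsBalAn1 hLc hr cE cVH cΛ cE₂ cB T j).S κ' (u + (Lc : ℤ) • t)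
      = shiftK (-((Lc : ℤ) • t)) ((JsBalAn1 hLc hr cE cVH cΛ cE₂ cB T j).S κ' u) :=
  JsBalT2Of_S_translate hLc cE cVH cΛ cE₂ cB T (hB_an1 hLc hr) (hmix_an1 hLc hr) j κ' u t

/-- **The wall's family member by member with an1's tables plugged in** (`d = 3`, any box root): an2's `TbalOf_JsBalT2Of` at
`hB := hB_an1 hLc hr`, `hmix := hmix_an1 hLc hr` — the statement is an2's, letter for letter, with `vh₂S := vh₂SAt (toSite r) Lc`,
`mixFF := mixFFAt (toSite r) Lc`. -/
theorem TbalOf_JsBalAn1 {Lc : ℕ} [NeZero Lc] {r : Fin (3 + 1) → ℕ} (hLc : 1 ≤ Lc) (hr : r ∈ box (3 + 1) Lc)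
    (cE cVH cΛ cE₂ cB : ℝ) (T : Fin 4 → Fin 4 → Fin 4 → Fin 4 → ℝ) (j : ℕ) :
    TbalOf Lc (JsBalAn1 hLc hr cE cVH cΛ cE₂ cB T) j
      = hessKer (axDressK Lc (KInvStep (d := 3) Lc j))
          (axVertexOfK (KInvStep (d := 3) Lc j) Lc
            (JsBal0Of hLc cE cVH cΛ
              (WbalT2Of (Lc := Lc) cE cVH cΛ cE₂ cB T (vh₂S := vh₂SAt (toSite r) Lc) (mixFF := mixFFAt (toSite r) Lc))
              (CwOf hLc cE cVH cΛ (T2Of_loc hLc cE cVH cΛ cE₂ cB T (hB_an1 hLc hr) (hmix_an1 hLc hr)) (hmix_an1 hLc hr))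
              (δwOf hLc cE cVH cΛ (T2Of_loc hLc cE cVH cΛ cE₂ cB T (hB_an1 hLc hr) (hmix_an1 hLc hr)) (hmix_an1 hLc hr))
              (δwOf_pos hLc cE cVH cΛ (T2Of_loc hLc cE cVH cΛ cE₂ cB T (hB_an1 hLc hr) (hmix_an1 hLc hr)) (hmix_an1 hLc hr))
              (WbalOf_loc₂ hLc cE cVH cΛ (T2Of_loc hLc cE cVH cΛ cE₂ cB T (hB_an1 hLc hr) (hmix_an1 hLc hr)) (hmix_an1 hLc hr))
              j).S)
          (WbalT2Of (Lc := Lc) cE cVH cΛ cE₂ cB T (vh₂S := vh₂SAt (toSite r) Lc) (mixFF := mixFFAt (toSite r) Lc) j) :=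
  TbalOf_JsBalT2Of hLc cE cVH cΛ cE₂ cB T (hB_an1 hLc hr) (hmix_an1 hLc hr) j

/-- The centred plugged-in family at `d = 3` as a named object (binders: `hLc`, colours, `T`). -/
def JsBalAn1Ctr {Lc : ℕ} [NeZero Lc] (hLc : 1 ≤ Lc) (cE cVH cΛ cE₂ cB : ℝ) (T : Fin 4 → Fin 4 → Fin 4 → Fin 4 → ℝ) :
    ℕ → JetData 3 Lc :=
  JsBalAn1 (d := 3) hLc (ctrOff_mem_box hLc) cE cVH cΛ cE₂ cB T

/-- `JsBalAn1Ctr` is `JsBalAn1` at the centred root, by `rfl`. -/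
theorem JsBalAn1Ctr_eq {Lc : ℕ} [NeZero Lc] (hLc : 1 ≤ Lc) (cE cVH cΛ cE₂ cB : ℝ) (T : Fin 4 → Fin 4 → Fin 4 → Fin 4 → ℝ) :
    JsBalAn1Ctr hLc cE cVH cΛ cE₂ cB T = JsBalAn1 (d := 3) hLc (ctrOff_mem_box hLc) cE cVH cΛ cE₂ cB T := rfl

/-- **The centred (P4) datum read through the wall's family**: `TbalOf_JsBalAn1` at the centred root `ctrOff (3+1) Lc`. -/
theorem TbalOf_JsBalAn1Ctr {Lc : ℕ} [NeZero Lc] (hLc : 1 ≤ Lc) (cE cVH cΛ cE₂ cB : ℝ) (T : Fin 4 → Fin 4 → Fin 4 → Fin 4 → ℝ) (j : ℕ) :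
    TbalOf Lc (JsBalAn1Ctr hLc cE cVH cΛ cE₂ cB T) j
      = hessKer (axDressK Lc (KInvStep (d := 3) Lc j))
          (axVertexOfK (KInvStep (d := 3) Lc j) Lc
            (JsBal0Of hLc cE cVH cΛ
              (WbalT2Of (Lc := Lc) cE cVH cΛ cE₂ cB T (vh₂S := vh₂SAt (toSite (ctrOff (3 + 1) Lc)) Lc)
                (mixFF := mixFFAt (toSite (ctrOff (3 + 1) Lc)) Lc))
              (CwOf hLc cE cVH cΛ (T2Of_loc hLc cE cVH cΛ cE₂ cB T (hB_an1 hLc (ctrOff_mem_box hLc)) (hmix_an1 hLc (ctrOff_mem_box hLc)))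
                (hmix_an1 hLc (ctrOff_mem_box hLc)))
              (δwOf hLc cE cVH cΛ (T2Of_loc hLc cE cVH cΛ cE₂ cB T (hB_an1 hLc (ctrOff_mem_box hLc)) (hmix_an1 hLc (ctrOff_mem_box hLc)))
                (hmix_an1 hLc (ctrOff_mem_box hLc)))
              (δwOf_pos hLc cE cVH cΛ (T2Of_loc hLc cE cVH cΛ cE₂ cB T (hB_an1 hLc (ctrOff_mem_box hLc)) (hmix_an1 hLc (ctrOff_mem_box hLc)))
                (hmix_an1 hLc (ctrOff_mem_box hLc)))
              (WbalOf_loc₂ hLc cE cVH cΛ (T2Of_loc hLc cE cVH cΛ cE₂ cB T (hB_an1 hLc (ctrOff_mem_box hLc)) (hmix_an1 hLc (ctrOff_mem_box hLc)))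
                (hmix_an1 hLc (ctrOff_mem_box hLc)))
              j).S)
          (WbalT2Of (Lc := Lc) cE cVH cΛ cE₂ cB T (vh₂S := vh₂SAt (toSite (ctrOff (3 + 1) Lc)) Lc)
            (mixFF := mixFFAt (toSite (ctrOff (3 + 1) Lc)) Lc) j) :=
  TbalOf_JsBalAn1 hLc (ctrOff_mem_box hLc) cE cVH cΛ cE₂ cB T j

/-- (Wt) for the centred family (`JsBalAn1_W_translate` at the centred root). -/
theorem JsBalAn1Ctr_W_translate {Lc : ℕ} [NeZero Lc] (hLc : 1 ≤ Lc) (cE cVH cΛ cE₂ cB : ℝ) (T : Fin 4 → Fin 4 → Fin 4 → Fin 4 → ℝ)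
    (j : ℕ) (μ : Fin (3 + 1)) (y : Fin (3 + 1) → ℤ) (ν : Fin (3 + 1)) (y' t : Fin (3 + 1) → ℤ) :
    (JsBalAn1Ctr hLc cE cVH cΛ cE₂ cB T j).W μ (y + t) ν (y' + t)
      = shiftK (-((Lc : ℤ) • t)) ((JsBalAn1Ctr hLc cE cVH cΛ cE₂ cB T j).W μ y ν y') :=
  JsBalAn1_W_translate hLc (ctrOff_mem_box hLc) cE cVH cΛ cE₂ cB T j μ y ν y' t

/-- (St♭) for the centred family. -/
theorem JsBalAn1Ctr_S_translate {Lc : ℕ} [NeZero Lc] (hLc : 1 ≤ Lc) (cE cVH cΛ cE₂ cB : ℝ) (T : Fin 4 → Fin 4 → Fin 4 → Fin 4 → ℝ)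
    (j : ℕ) (κ' : Fin (3 + 1)) (u t : Fin (3 + 1) → ℤ) :
    (JsBalAn1Ctr hLc cE cVH cΛ cE₂ cB T j).S κ' (u + (Lc : ℤ) • t)
      = shiftK (-((Lc : ℤ) • t)) ((JsBalAn1Ctr hLc cE cVH cΛ cE₂ cB T j).S κ' u) :=
  JsBalAn1_S_translate hLc (ctrOff_mem_box hLc) cE cVH cΛ cE₂ cB T j κ' u t


end

end Summit.QuantumFields.BalabanUV.Beta.MixedJetTablesPlug
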